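import Summits.QuantumFields.BalabanUV.T4Continuum.Support.NE7EtaBackgroundFlatStratum
import HarnessLib

/-!
# NE7EtaBackgroundFlatStratumZero — route #1 of the NE7 crux (node U5): the flat stratum of NODE O's background coordinate in its
# ZERO-ACTION and ZERO-CURVATURE descriptions; strictness over the base point (torons); the four (A)-dischargers in docked form

Cell `pub-balaban`, rung (B)+1 sub-cell t4, lineage `b2b-balaban-t4-ne7-p1`, generation 58 (CRUX PROVER NE7 #1, ruling e34b3e0c (2));
crux skeleton `t4/skeletons/NE7-CRUX-R1.md` v1.7.17 §2 (stub S7 = NODE O's background coordinate) ∕ §3quindecies; part 2 of 2 (part 1 =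
`Support/NE7EtaBackgroundFlatStratum`: quasi-periodic gauges, `hdom`, (H∃) `hmin`, minimisers of flat data, NE3's covariant root with
`Z = 0`, uniqueness modulo periodic gauge — all on the pure-gauge description `{v N-periodic | ∃ w unitary, v = 1^{w}}`).
HONEST FRAMING (page 1): FIXED FINITE T⁴, rung (B)+1; NE7 is the cell's OWN estimate, NOT PRINTED in [Balaban1984PropagatorsI]–
[Balaban1989LargeFieldII] and NOT PROVED here; continuum YM on T⁴ ⇐ BetaPertH ∧ nine spine estimates (0/9 proved); BetaPertH ⇐ (D1) ∧
(D4) ∧ CAP+tail; G-an2-4 gates asym, D1 and NE2/3/4; NOT infinite volume, NOT mass gap, NOT Clay.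

WHAT ([folklore]; 0 def; 0 sorry).
 * §6 THE THREE DESCRIPTIONS COINCIDE: **`flatStratum_eq_levelAction_zero`** — for `L, N ≥ 1`, `ε ≥ 0` the pure-gauge stratum IS the
   zero set `{v ∈ sfClass d L N ε 0 | A^{(0)}(v) = 0}` of the level-`0` action inside the datum class (`⊆`: pure gauges have action `0`;
   `⊇`: zero action ⇒ zero curvature ⇒ pure gauge on `ℤ^d`, `NE3EnergyRateFlatClass`); **`flatStratum_eq_plaquettes_one`** — it is the
   set of `U(n)`-valued `N`-periodic configurations all of whose plaquette variables are `1`.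
 * §7 STRICTNESS: `const_mem_flatStratum` (every constant unitary configuration — a toron — is flat: `c = 1^{x ↦ c^{−Σ x_i}}`),
   `flatOrbit_one_eq_singleton` (for `N = 1` generation 57's orbit is the single point `1`), `const_neg_one_ne_flatCfg`; so the stratum
   is STRICTLY larger than the base point.  THE DISCHARGERS IN DOCKED FORM: `gaugeAct_mem_flatStratum₀`, `flatCfg_mem_flatStratum₀`,
   `hmin_flatStratum₀`, `covRoot_flatStratum₀`, `minimiser_unique_mod_gauge_flatStratum₀` — the four (A)-binders of
   `NE7Route1EndDocked.goodClause_summable_of_route1_docked` (and X-A2's (β)) LITERALLY, with `dom := {v | v ∈ sfClass d L N ε 0 ∧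
   levelAction d L N 0 v = 0}`, consumed by `Support/NE7Route1EndDockedFlatStratum`.
 * §8 (v1.1) **`exists_periodic_gauge_eq_rescale_bavg_flatStratum`** — the two runs of a flat datum are EXACTLY gauge equivalent by a
   unitary `(N·L^k)`-PERIODIC gauge (`U_A^{u} = rescale L (bavg L U_B)` on the nose); hence ROW NE3's OWN root shapes BY NAME on the
   stratum: **`ne3EnergyRate_sfClass_flatStratum`** (P2's T-E `NE3EnergyShapes.NE3EnergyRate d (sfClass d L N ε) L N b g C ·`, the crew's
   flat-DATUM witness `NE3EnergyRateFlatClass.ne3EnergyRate_sfClass_flat` extended to all flat data), **`ne3EnergyRateW_sfClass_flatStratum`**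
   (T-E_w), and their zero-action forms `…₀`.
HONEST: a ZERO-CURVATURE statement (`Z = 0`); nothing at a datum with curvature, where NE3's root and (H∃) remain HYPOTHESES (X-A4,
unseated); NOT NE3, NOT NE7; nothing printed is asserted; no `def`, no `sorry`, axioms ⊆ {propext, Classical.choice, Quot.sound}; route
1 stays KERNEL-COMPLETE AT FORM LEVEL ∕ DEPENDENT; NE7 NOT proved; spine 0∕9.
-/

set_option autoImplicit false

open scoped BigOperators Matrix Matrix.Norms.L2Operator
open NormedSpace Finset

namespace Summit.QuantumFields.BalabanUV.T4Continuum.NE7EtaBackgroundFlatStratumZero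

open Literature.MathematicalPhysics.QuantumFieldTheory.Balaban1983to89
open B7Prop1Explicit B7Prop2Explicit MatrixLog UnitaryModel
open T4AveragingDeficitWall hiding Site Plane Plaq Bond
open T4AveragingDeficitWallBoundary (IsPeriodicCfg periodBox)
open B7AvgGaugeCovariance (uLev uLev_apply)
open AveragingDeficitPeriodicCounting (IsPeriodicDir isPeriodicDir_zero)
open AveragingDeficitNearIdentity (Ad_zero)
open AveragingDeficitKDatum (isUnitaryCfg_gaugeAct)
open BlockAverageCurrent (smallField_gaugeAct)
open MinimalActionLevels (levelAction levelAction_nonneg)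
open MinimalActionSandwich (IsMinimiser admissible)
open MinimalActionRate (sfClass Regular)
open MinimalActionRefine (RegularSup)
open MinimalActionWitness (flatCfg avgIter_flatCfg flatCfg_mem_sfClass levelAction_flatCfg isPeriodicCfg_flatCfg)
open NE3EnergyShapes (residualScale residualScale_nonneg IsUnitarySite IsPeriodicSite)
open NE3EnergyWeightedShapes (energyNormW energyNormW_zero)
open NE3ResidualSliceRep (isPeriodicCfg_gaugeAct)
open NE3EnergyRateFlatClass (hol_plaqWord_eq_one_of_levelAction_eq_zero exists_unitary_gauge_eq_gaugeAct_flatCfg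
  avgIter_gaugeAct_flatCfg apply_eq_apply_zero_of_gaugeAct_flatCfg_eq apply_eq_apply_zero_of_forall_add_e gaugeAct_inv_gaugeAct')
open NE3ClassSixFlatWitness (hol_gaugeAct_flatCfg_plaqWord fhol_gaugeAct_flatCfg)
open NE7EtaMinimiserGaugeCovariance (levelAction_gaugeAct)
open NE7EtaBackgroundFlatOrbit (uLev_blowup isUnitarySite_blowup)
open NE7EtaBackgroundFlatStratum (isUnitaryCfg_gaugeAct_flatCfg gaugeAct_flatCfg_mem_sfClass gaugeAct_mem_flatStratum
  hmin_flatStratum covRoot_flatStratum minimiser_unique_mod_gauge_flatStratum)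

noncomputable section

variable {d : ℕ} {n : Type*} [Fintype n] [DecidableEq n]

/-! ## §6 The three descriptions of the flat stratum coincide -/

/-- **PURE-GAUGE = ZERO-ACTION DESCRIPTION**: for `L, N ≥ 1`, `ε ≥ 0` the flat stratum `{v N-periodic | ∃ w unitary, v = 1^{w}}` is the
zero set of the level-`0` action inside the datum class `sfClass d L N ε 0` (`⊆`: pure gauges have action `0`, `levelAction_gaugeAct`;
`⊇`: zero action ⇒ zero curvature ⇒ pure gauge on `ℤ^d`). [folklore] -/
theorem flatStratum_eq_levelAction_zero [Nonempty n] {L N : ℕ} (hL : 1 ≤ L) (hN : 1 ≤ N) {ε : ℝ} (hε : 0 ≤ ε) :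
    {v : Site d → Fin d → (Matrix n n ℂ)ˣ | IsPeriodicCfg v (N : ℤ) ∧ ∃ w : Site d → (Matrix n n ℂ)ˣ,
        IsUnitarySite w ∧ v = gaugeAct w flatCfg}
      = {v : Site d → Fin d → (Matrix n n ℂ)ˣ | v ∈ sfClass d L N ε 0 ∧ levelAction d L N 0 v = 0} := by
  have hcast : ((N * L ^ 0 : ℕ) : ℤ) = (N : ℤ) := by push_cast; ring
  ext v
  constructor
  · rintro ⟨hvP, w, hwu, rfl⟩
    exact ⟨gaugeAct_flatCfg_mem_sfClass hε hwu (by rw [hcast]; exact hvP), by rw [levelAction_gaugeAct, levelAction_flatCfg]⟩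
  · rintro ⟨⟨hunit, hper, -⟩, hA0⟩
    have hflat := hol_plaqWord_eq_one_of_levelAction_eq_zero (k := 0) hL hN hunit hper hA0
    obtain ⟨g, hgu, rfl⟩ := exists_unitary_gauge_eq_gaugeAct_flatCfg hunit hflat
    exact ⟨by rw [← hcast]; exact hper, g, hgu, rfl⟩

/-- **PURE-GAUGE = ZERO-CURVATURE DESCRIPTION**: the flat stratum is the set of `U(n)`-valued `N`-periodic configurations all of whose
plaquette variables are `1` (zero curvature ⇒ pure gauge on `ℤ^d`, `exists_unitary_gauge_eq_gaugeAct_flatCfg`). [folklore] -/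
theorem flatStratum_eq_plaquettes_one [Nonempty n] (N : ℕ) :
    {v : Site d → Fin d → (Matrix n n ℂ)ˣ | IsPeriodicCfg v (N : ℤ) ∧ ∃ w : Site d → (Matrix n n ℂ)ˣ,
        IsUnitarySite w ∧ v = gaugeAct w flatCfg}
      = {v : Site d → Fin d → (Matrix n n ℂ)ˣ | IsUnitaryCfg v ∧ IsPeriodicCfg v (N : ℤ) ∧
          ∀ (x : Site d) (κ μ : Fin d), κ ≠ μ → hol v x (plaqWord κ μ) = 1} := by
  ext v
  constructor
  · rintro ⟨hvP, w, hwu, rfl⟩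
    exact ⟨isUnitaryCfg_gaugeAct_flatCfg hwu, hvP, fun x κ μ _ => hol_gaugeAct_flatCfg_plaqWord w x κ μ⟩
  · rintro ⟨hunit, hper, hflat⟩
    obtain ⟨g, hgu, rfl⟩ := exists_unitary_gauge_eq_gaugeAct_flatCfg hunit hflat
    exact ⟨hper, g, hgu, rfl⟩

/-! ## §7 Strictness (the stratum is larger than the base point) and the four dischargers on the zero-action description -/

/-- **CONSTANT COMMUTING CONFIGURATIONS (TORONS) ARE FLAT**: for a unitary `c`, the constant configuration `v(x, μ) = c` is `N`-periodic
for every `N` and is the pure gauge `1^{w}` with `w(x) = c^{−Σ_i x_i}`; it lies in the flat stratum. [folklore] -/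
theorem const_mem_flatStratum (N : ℕ) {c : (Matrix n n ℂ)ˣ} (hc : c ∈ unitaryUnits (Matrix n n ℂ)) :
    (fun (_ : Site d) (_ : Fin d) => c) ∈ {v : Site d → Fin d → (Matrix n n ℂ)ˣ | IsPeriodicCfg v (N : ℤ) ∧
        ∃ w : Site d → (Matrix n n ℂ)ˣ, IsUnitarySite w ∧ v = gaugeAct w flatCfg} := by
  refine ⟨fun _ _ _ => rfl, fun x => c ^ (-(∑ i, x i)), fun x => (unitaryUnits (Matrix n n ℂ)).zpow_mem hc _, ?_⟩
  funext x μ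
  have hsum : ∑ i, (x + e μ) i = (∑ i, x i) + 1 := by
    simp only [Pi.add_apply, Finset.sum_add_distrib, e, Finset.sum_pi_single', Finset.mem_univ, if_true]
  simp only [gaugeAct, flatCfg, mul_one, hsum, zpow_neg, inv_inv]
  rw [← zpow_neg, ← zpow_add]
  have h1 : -(∑ i, x i) + (∑ i, x i + 1) = 1 := by ring
  rw [h1, zpow_one]

/-- **FOR `N = 1` THE BASE POINT IS A SINGLE POINT**: a `1`-periodic site gauge is constant, so generation 57's flat orbit at `N = 1` is
`{1}` — while the flat stratum at `N = 1` contains every constant unitary configuration (`const_mem_flatStratum`); the stratum is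
strictly larger than the orbit as soon as `U(n) ≠ {1}`. [folklore] -/
theorem flatOrbit_one_eq_singleton :
    {v : Site d → Fin d → (Matrix n n ℂ)ˣ | ∃ w : Site d → (Matrix n n ℂ)ˣ,
        IsUnitarySite w ∧ IsPeriodicSite w ((1 : ℕ) : ℤ) ∧ v = gaugeAct w flatCfg} = {flatCfg} := by
  ext v
  simp only [Set.mem_setOf_eq, Set.mem_singleton_iff]
  constructor
  · rintro ⟨w, -, hwp, rfl⟩
    have hconst : ∀ z : Site d, w z = w 0 :=
      apply_eq_apply_zero_of_forall_add_e fun z μ => by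
        have h := hwp z μ
        rwa [Nat.cast_one, one_smul] at h
    funext x μ
    simp only [gaugeAct, flatCfg, mul_one, hconst x, hconst (x + e μ), mul_inv_cancel]
  · rintro rfl
    exact ⟨fun _ => 1, fun _ => (unitaryUnits (Matrix n n ℂ)).one_mem, fun _ _ => rfl, by
      funext x μ; simp only [gaugeAct, one_mul, inv_one, mul_one]⟩

/-- The constant configuration `−1` is flat but is NOT the flat configuration (`n` non-empty): with `flatOrbit_one_eq_singleton` and
`const_mem_flatStratum`, the flat stratum at `N = 1` is STRICTLY larger than the flat orbit. [folklore] -/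
theorem const_neg_one_ne_flatCfg [Nonempty n] [NeZero d] :
    (fun (_ : Site d) (_ : Fin d) => (-1 : (Matrix n n ℂ)ˣ)) ≠ flatCfg := by
  intro h
  have h1 := congrArg (fun v : Site d → Fin d → (Matrix n n ℂ)ˣ => ((v 0 0 : (Matrix n n ℂ)ˣ) : Matrix n n ℂ)) h
  simp only [flatCfg, Units.val_neg, Units.val_one] at h1
  have i : n := Classical.arbitrary n
  have h2 := congrFun (congrFun h1 i) i
  simp only [Matrix.neg_apply, Matrix.one_apply_eq] at h2
  norm_num at h2

/-- **`hdom` on the zero-action description of the flat stratum** (`L, N ≥ 1`, `ε ≥ 0`). [folklore] -/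
theorem gaugeAct_mem_flatStratum₀ [Nonempty n] {L N : ℕ} (hL : 1 ≤ L) (hN : 1 ≤ N) {ε : ℝ} (hε : 0 ≤ ε) :
    ∀ v ∈ {v : Site d → Fin d → (Matrix n n ℂ)ˣ | v ∈ sfClass d L N ε 0 ∧ levelAction d L N 0 v = 0},
      ∀ w' : Site d → (Matrix n n ℂ)ˣ, IsUnitarySite w' → IsPeriodicSite w' (N : ℤ) →
        gaugeAct w' v ∈ {v : Site d → Fin d → (Matrix n n ℂ)ˣ | v ∈ sfClass d L N ε 0 ∧ levelAction d L N 0 v = 0} := by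
  rw [← flatStratum_eq_levelAction_zero hL hN hε]
  exact gaugeAct_mem_flatStratum N

/-- **`hv₁` on the zero-action description of the flat stratum** (`ε ≥ 0`). [folklore] -/
theorem flatCfg_mem_flatStratum₀ [Nonempty n] (L N : ℕ) {ε : ℝ} (hε : 0 ≤ ε) :
    (flatCfg : Site d → Fin d → (Matrix n n ℂ)ˣ)
      ∈ {v : Site d → Fin d → (Matrix n n ℂ)ˣ | v ∈ sfClass d L N ε 0 ∧ levelAction d L N 0 v = 0} :=
  ⟨flatCfg_mem_sfClass L N hε 0, levelAction_flatCfg L N 0⟩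

/-- **(H∃) `hmin` on the zero-action description of the flat stratum** (`L, N ≥ 1`, `ε, b, c ≥ 0`). [folklore] -/
theorem hmin_flatStratum₀ [Nonempty n] {L N : ℕ} (hL : 1 ≤ L) (hN : 1 ≤ N) {ε b c : ℝ} (hε : 0 ≤ ε) (hb : 0 ≤ b) (hc : 0 ≤ c) :
    ∀ V ∈ {v : Site d → Fin d → (Matrix n n ℂ)ˣ | v ∈ sfClass d L N ε 0 ∧ levelAction d L N 0 v = 0},
      ∀ k : ℕ, ∃ U, IsMinimiser d (sfClass d L N ε) L N k V U ∧ RegularSup d L N b c k U := by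
  rw [← flatStratum_eq_levelAction_zero hL hN hε]
  exact hmin_flatStratum hL hε hb hc

/-- **NE3's covariant root amendment 4 on the zero-action description of the flat stratum**, `Z = 0` (`L, N ≥ 1`, `ε ≥ 0`,
`C, Λ₁, Λ₂′ ≥ 0`). [folklore] -/
theorem covRoot_flatStratum₀ [Nonempty n] {L N : ℕ} (hL : 1 ≤ L) (hN : 1 ≤ N) {ε : ℝ} (hε : 0 ≤ ε) (b g : ℝ)
    {C Λ₁ Λ₂' : ℝ} (hC : 0 ≤ C) (hΛ₁ : 0 ≤ Λ₁) (hΛ₂' : 0 ≤ Λ₂') :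
    ∀ k : ℕ, 1 ≤ k → ∀ V ∈ {v : Site d → Fin d → (Matrix n n ℂ)ˣ | v ∈ sfClass d L N ε 0 ∧ levelAction d L N 0 v = 0},
      ∀ UA UB : (Site d → Fin d → (Matrix n n ℂ)ˣ),
      IsMinimiser d (sfClass d L N ε) L N k V UA → IsMinimiser d (sfClass d L N ε) L N (k + 1) V UB →
        Regular d L N b g (k + 1) UB →
        ∃ (u : Site d → (Matrix n n ℂ)ˣ) (Z : Site d → Fin d → Matrix n n ℂ),
          IsUnitarySite u ∧ IsPeriodicSite u ((N * L ^ k : ℕ) : ℤ) ∧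
          IsSkewDir Z ∧ IsPeriodicDir Z ((N * L ^ k : ℕ) : ℤ) ∧
          gaugeAct u UA = vary (rescale L (bavg L UB)) Z 1 ∧
          energyNormW L k (rescale L (bavg L UB)) Z (periodBox (N * L ^ k)) ≤ C * residualScale d L N b g k ∧
          (∀ (κ : Fin d) (x : Site d) (μ : Fin d),
            ‖Ad (rescale L (bavg L UB) (x + e κ) μ) (Z (x + e μ) κ) - Z x κ‖ ≤ Λ₁ * (((L : ℝ)⁻¹) ^ k) ^ 2) ∧
          (∀ (κ μ : Fin d) (y : Site d),
            ‖Ad (rescale L (bavg L UB) (y + e κ) μ)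
                (Ad (rescale L (bavg L UB) (y + e κ + e μ) μ) (Z (y + (2 : ℕ) • e μ) κ) - Z (y + e μ) κ)
              - (Ad (rescale L (bavg L UB) (y + e κ) μ) (Z (y + e μ) κ) - Z y κ)‖ ≤ Λ₂' * (((L : ℝ)⁻¹) ^ k) ^ 3) := by
  rw [← flatStratum_eq_levelAction_zero hL hN hε]
  exact covRoot_flatStratum hL hN hε b g hC hΛ₁ hΛ₂'

/-- **MINIMISERS OF A ZERO-ACTION DATUM ARE UNIQUE MODULO PERIODIC GAUGE** (the zero-action description; `L, N ≥ 1`, `ε ≥ 0`).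
[folklore] -/
theorem minimiser_unique_mod_gauge_flatStratum₀ [Nonempty n] {L N : ℕ} (hL : 1 ≤ L) (hN : 1 ≤ N) {ε : ℝ} (hε : 0 ≤ ε)
    {V : Site d → Fin d → (Matrix n n ℂ)ˣ}
    (hV : V ∈ {v : Site d → Fin d → (Matrix n n ℂ)ˣ | v ∈ sfClass d L N ε 0 ∧ levelAction d L N 0 v = 0}) {k : ℕ}
    {U U' : Site d → Fin d → (Matrix n n ℂ)ˣ} (hU : IsMinimiser d (sfClass d L N ε) L N k V U)
    (hU' : IsMinimiser d (sfClass d L N ε) L N k V U') :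
    ∃ u : Site d → (Matrix n n ℂ)ˣ, IsUnitarySite u ∧ IsPeriodicSite u ((N * L ^ k : ℕ) : ℤ) ∧ U' = gaugeAct u U := by
  rw [← flatStratum_eq_levelAction_zero hL hN hε] at hV
  obtain ⟨hVP, w, hwu, rfl⟩ := hV
  exact minimiser_unique_mod_gauge_flatStratum hL hN hε hwu hVP hU hU'

/-! ## §8 Exact gauge equivalence of the two runs on the stratum; row NE3's own root shapes T-E ∕ T-E_w BY NAME there -/

open NE7EtaBackgroundFlatStratum (exists_gauge_of_isMinimiser_flatStratum apply_add_period_of_uLev_eq)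
open NE3EnergyShapes (NE3EnergyRate energyNorm_zero)
open NE3EnergyWeightedShapes (NE3EnergyRateW ne3EnergyRateW_of_ne3EnergyRate)

/-- **THE TWO RUNS OF A FLAT DATUM ARE EXACTLY GAUGE EQUIVALENT BY A PERIODIC GAUGE**: for `L, N ≥ 1`, `ε ≥ 0`, a flat `N`-periodic datum
`1^{w}` (`w` unitary), a run-`k` minimiser `U_A` and a run-`(k+1)` minimiser `U_B` in `sfClass ε`, there is a unitary `(N·L^k)`-PERIODIC `u`
with `U_A^{u} = rescale L (bavg L U_B)` on the nose (the construction inside `covRoot_flatStratum`, exported without the letters: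
`u = (g_B∘(L•))·g_A⁻¹` for the corner-normalised gauges of §4, whose common holonomy constants cancel). [folklore] -/
theorem exists_periodic_gauge_eq_rescale_bavg_flatStratum [Nonempty n] {L N : ℕ} (hL : 1 ≤ L) (hN : 1 ≤ N) {ε : ℝ} (hε : 0 ≤ ε)
    {w : Site d → (Matrix n n ℂ)ˣ} (hwu : IsUnitarySite w)
    (hwP : IsPeriodicCfg (gaugeAct w (flatCfg : Site d → Fin d → (Matrix n n ℂ)ˣ)) (N : ℤ)) {k : ℕ}
    {UA UB : Site d → Fin d → (Matrix n n ℂ)ˣ} (hA : IsMinimiser d (sfClass d L N ε) L N k (gaugeAct w flatCfg) UA)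
    (hB : IsMinimiser d (sfClass d L N ε) L N (k + 1) (gaugeAct w flatCfg) UB) :
    ∃ u : Site d → (Matrix n n ℂ)ˣ, IsUnitarySite u ∧ IsPeriodicSite u ((N * L ^ k : ℕ) : ℤ) ∧
      gaugeAct u UA = rescale L (bavg L UB) := by
  have hperA : IsPeriodicCfg UA ((N * L ^ k : ℕ) : ℤ) := hA.mem.1.2.1
  have hperB : IsPeriodicCfg UB ((N * L ^ (k + 1) : ℕ) : ℤ) := hB.mem.1.2.1
  obtain ⟨gA, hgAu, hUA, hgAw⟩ := exists_gauge_of_isMinimiser_flatStratum hL hN hε hwu hwP hA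
  obtain ⟨gB, hgBu, hUB, hgBw⟩ := exists_gauge_of_isMinimiser_flatStratum hL hN hε hwu hwP hB
  have hW : rescale L (bavg L UB) = gaugeAct (uLev L gB 1) flatCfg := by
    have h := avgIter_gaugeAct_flatCfg L gB 1
    rw [← hUB] at h
    exact h
  refine ⟨fun x => uLev L gB 1 x * (gA x)⁻¹,
    fun x => (unitaryUnits (Matrix n n ℂ)).mul_mem (hgBu _) ((unitaryUnits (Matrix n n ℂ)).inv_mem (hgAu x)),
    fun x i => ?_, ?_⟩
  · have hB' : gB ((L : ℤ) • x + ((N * L ^ (k + 1) : ℕ) : ℤ) • e i) = gB ((L : ℤ) • x) * ((w 0)⁻¹ * w ((N : ℤ) • e i)) :=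
      apply_add_period_of_uLev_eq (hUB ▸ hperB) hgBw _ i
    have hcast : (L : ℤ) * ((N * L ^ k : ℕ) : ℤ) = ((N * L ^ (k + 1) : ℕ) : ℤ) := by push_cast; ring
    simp only [uLev_apply, pow_one]
    rw [smul_add, smul_smul, hcast, hB', apply_add_period_of_uLev_eq (hUA ▸ hperA) hgAw x i, mul_inv_rev]
    group
  · rw [hW, hUA]
    funext x μ
    simp only [gaugeAct, flatCfg, mul_one]
    group

/-- **P2's ROOT T-E (`NE3EnergyShapes.NE3EnergyRate`) ON THE WHOLE FLAT STRATUM** over the genuine small-field class `sfClass ε`: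
`NE3EnergyRate d (sfClass d L N ε) L N b g C {v N-periodic | ∃ w unitary, v = 1^{w}}` for `L, N ≥ 1`, `ε ≥ 0`, all `b, g`, every
`C ≥ 0` — the NE3 crew's flat-DATUM witness `NE3EnergyRateFlatClass.ne3EnergyRate_sfClass_flat` (`dom = {1}`) extended to ALL flat data,
torons included (`Z = 0`, energy `0`).  Row NE3's shape BY NAME; NE3 is NOT proved by it. [folklore] -/
theorem ne3EnergyRate_sfClass_flatStratum [Nonempty n] {L N : ℕ} (hL : 1 ≤ L) (hN : 1 ≤ N) {ε : ℝ} (hε : 0 ≤ ε) (b g : ℝ)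
    {C : ℝ} (hC : 0 ≤ C) :
    NE3EnergyRate d (sfClass (n := n) d L N ε) L N b g C
      {v : Site d → Fin d → (Matrix n n ℂ)ˣ | IsPeriodicCfg v (N : ℤ) ∧ ∃ w : Site d → (Matrix n n ℂ)ˣ,
        IsUnitarySite w ∧ v = gaugeAct w flatCfg} := by
  rintro k - V ⟨hVP, w, hwu, rfl⟩ UA UB hA hB -
  obtain ⟨u, hu, huP, hrep⟩ := exists_periodic_gauge_eq_rescale_bavg_flatStratum hL hN hε hwu hVP hA hB
  exact ⟨u, fun _ _ => 0, hu, huP, fun _ _ => (skewAdjoint (Matrix n n ℂ)).zero_mem, isPeriodicDir_zero _,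
    by rw [vary_zero_dir, hrep], by rw [energyNorm_zero]; exact mul_nonneg hC (residualScale_nonneg d L N b g k)⟩

/-- **THE RE-TYPED ROOT T-E_w (`NE3EnergyWeightedShapes.NE3EnergyRateW`) ON THE WHOLE FLAT STRATUM** over `sfClass ε` (`L, N ≥ 1`,
`ε ≥ 0`, all `b, g`, `C ≥ 0`) — by `ne3EnergyRateW_of_ne3EnergyRate`.  Row NE3's shape BY NAME; NE3 is NOT proved by it. [folklore] -/
theorem ne3EnergyRateW_sfClass_flatStratum [Nonempty n] {L N : ℕ} (hL : 1 ≤ L) (hN : 1 ≤ N) {ε : ℝ} (hε : 0 ≤ ε) (b g : ℝ)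
    {C : ℝ} (hC : 0 ≤ C) :
    NE3EnergyRateW d (sfClass (n := n) d L N ε) L N b g C
      {v : Site d → Fin d → (Matrix n n ℂ)ˣ | IsPeriodicCfg v (N : ℤ) ∧ ∃ w : Site d → (Matrix n n ℂ)ˣ,
        IsUnitarySite w ∧ v = gaugeAct w flatCfg} :=
  ne3EnergyRateW_of_ne3EnergyRate hL (ne3EnergyRate_sfClass_flatStratum hL hN hε b g hC)

/-- P2's root T-E on the ZERO-ACTION description of the flat stratum (`L, N ≥ 1`, `ε ≥ 0`, `C ≥ 0`). [folklore] -/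
theorem ne3EnergyRate_sfClass_flatStratum₀ [Nonempty n] {L N : ℕ} (hL : 1 ≤ L) (hN : 1 ≤ N) {ε : ℝ} (hε : 0 ≤ ε) (b g : ℝ)
    {C : ℝ} (hC : 0 ≤ C) :
    NE3EnergyRate d (sfClass (n := n) d L N ε) L N b g C
      {v : Site d → Fin d → (Matrix n n ℂ)ˣ | v ∈ sfClass d L N ε 0 ∧ levelAction d L N 0 v = 0} := by
  rw [← flatStratum_eq_levelAction_zero hL hN hε]
  exact ne3EnergyRate_sfClass_flatStratum hL hN hε b g hC

/-- The re-typed root T-E_w on the ZERO-ACTION description of the flat stratum (`L, N ≥ 1`, `ε ≥ 0`, `C ≥ 0`). [folklore] -/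
theorem ne3EnergyRateW_sfClass_flatStratum₀ [Nonempty n] {L N : ℕ} (hL : 1 ≤ L) (hN : 1 ≤ N) {ε : ℝ} (hε : 0 ≤ ε) (b g : ℝ)
    {C : ℝ} (hC : 0 ≤ C) :
    NE3EnergyRateW d (sfClass (n := n) d L N ε) L N b g C
      {v : Site d → Fin d → (Matrix n n ℂ)ˣ | v ∈ sfClass d L N ε 0 ∧ levelAction d L N 0 v = 0} := by
  rw [← flatStratum_eq_levelAction_zero hL hN hε]
  exact ne3EnergyRateW_sfClass_flatStratum hL hN hε b g hC

end

end Summit.QuantumFields.BalabanUV.T4Continuum.NE7EtaBackgroundFlatStratumZero
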